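import Summits.CriticalPhenomena.PercolationContinuityZ3.Theorems.PercNearOneGluingNoHeavyRsw3AnnulusTwoArmLowerBound
import HarnessLib

/-!
# Monotonicity of the annulus two-arm probability in the aspect ratio, and how the thin-aspect theorem sits
# below the lane's aspect-2 statement `Crossing.AnnulusTwoArmLowerBound`

builds on p205010 (kernel theorem, internal audit signed; external expert review pending)

RSW3 lane (LANE 3), seat `prim-rsw3-p2` (gen 4).  Helper file for the crux `stmt-CriticalPhenomena-4575` (`--supports`).
No definitions, no named facts, no sorries.  `α₂(m, N) = Crossing.annulusTwoArmProb 3 p m N = P_p((uniqZone m N)ᶜ)`.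

The census and LANE 4 read `α₂` as a function of the aspect ratio `N/m` that DECREASES with the aspect; this file makes the
two monotonicities kernel facts and records (memo P2-RSWLITE §10, V18) why gen 4's theorem
`Rsw3.annulusTwoArmProb_criticalProbI_lower_of_aspect` (aspect `≤ 1 + 1/K`) is formally WEAKER than the lane's
`Crossing.AnnulusTwoArmLowerBound` (aspect `2`, defs v2 p207879), which stays open:
* `compl_uniqZone_subset_of_inner_le` — `(uniqZone k N)ᶜ ⊆ (uniqZone k' N)ᶜ` for `k ≤ k'` (a larger inner box constrains
  more pairs); `annulusTwoArmProb_mono_inner`;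
* `mem_compl_uniqZone_of_outer_le` — for lattice configurations and `k ≤ N ≤ N'`, `(uniqZone k N')ᶜ ⊆ (uniqZone k N)ᶜ`
  (stop the two arms at their first exit from `Λ(N)`; "in `Λ(N)`" is monotone); `annulusTwoArmProb_anti_outer`;
* `annulusTwoArmProb_anti_aspect` — both together: `m ≤ m' < N' ≤ N` ⇒ `α₂(m, N) ≤ α₂(m', N')`;
* `forall_aspect_le_two_of_annulusTwoArmLowerBound` — `AnnulusTwoArmLowerBound` ⇒ the same constant bounds `α₂(m, N)` for
  EVERY `m < N ≤ 2m` — in particular it implies the conclusion of the thin-aspect theorem (with its own constant), not conversely.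

References: S. Martineau, V. Tassion, Ann. Probab. 45 (2017), proof of Lemma 3.7 (first-exit monotonicity of the bad pairs)
[MartineauTassion2017]; G. Grimmett, *Percolation* (1999), §1.4 [GrimmettPercolation1999].
-/

noncomputable section

namespace Summit.CriticalPhenomena.PercolationContinuityZ3.Theorems.Rsw3

open MeasureTheory Literature.Probability.LatticeModels Literature.Probability.Percolation
open Summit.CriticalPhenomena.PercolationContinuityZ3.Theorems.Crossing

/-! ## Monotonicity in the inner radius -/

/-- **A larger inner box makes non-uniqueness easier**: for `k ≤ k'`, `(uniqZone k N)ᶜ ⊆ (uniqZone k' N)ᶜ` (the witnesses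
`x, y ∈ Λ(k)` lie in `Λ(k')`). [cite: MartineauTassion2017, §3.1.2] -/
theorem compl_uniqZone_subset_of_inner_le {d k k' N : ℕ} (h : k ≤ k') :
    (uniqZone (d := d) k N)ᶜ ⊆ (uniqZone (d := d) k' N)ᶜ := by
  intro ω hω hU
  exact hω fun x hx y hy hbx hby => hU x (box_mono d h hx) y (box_mono d h hy) hbx hby

/-- **`α₂(k, N) ≤ α₂(k', N)` for `k ≤ k'`** (every `p`, every `d`). [cite: MartineauTassion2017, §3.1.2] -/
theorem annulusTwoArmProb_mono_inner {d : ℕ} (p : unitInterval) {k k' N : ℕ} (h : k ≤ k') :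
    annulusTwoArmProb d p k N ≤ annulusTwoArmProb d p k' N :=
  measureReal_mono (compl_uniqZone_subset_of_inner_le h) (measure_ne_top _ _)

/-! ## Monotonicity in the outer radius -/

/-- **A larger outer box makes non-uniqueness harder**: for a lattice configuration `ω ⊆ E(ℤ^d)` and `k ≤ N ≤ N'`,
`ω ∈ (uniqZone k N')ᶜ → ω ∈ (uniqZone k N)ᶜ` — two vertices of `Λ(k)` reaching `∂ⁱⁿΛ(N')` inside `Λ(N')` without being
joined inside `Λ(N')` reach `∂ⁱⁿΛ(N)` inside `Λ(N)` (first exit, `badPair_add_antitone`) and are not joined inside `Λ(N) ⊆ Λ(N')`.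
[cite: MartineauTassion2017, proof of Lemma 3.7 (monotonicity of the bad pairs)] -/
theorem mem_compl_uniqZone_of_outer_le {d k N N' : ℕ} (hkN : k ≤ N) (hNN' : N ≤ N') {ω : BondConfig (Site d)}
    (hω : ω ⊆ (zdGraph d).edgeSet) (h : ω ∈ (uniqZone (d := d) k N')ᶜ) : ω ∈ (uniqZone (d := d) k N)ᶜ := by
  intro hU
  apply h
  intro x hx y hy hbx hby
  -- the bad pair at radius `N' = k + (N' - k)` gives the bad pair at radius `N = k + (N - k)`
  by_contra hxy
  have hbad' : ω ∈ badPair N' x y := ⟨⟨hbx, hby⟩, hxy⟩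
  have e' : N' = k + (N' - k) := by omega
  have e : N = k + (N - k) := by omega
  rw [e'] at hbad'
  have hbad : ω ∈ badPair (k + (N - k)) x y := badPair_add_antitone hx hy hω (by omega) hbad'
  rw [← e] at hbad
  exact hbad.2 (hU x hx y hy hbad.1.1 hbad.1.2)

/-- **`α₂(k, N') ≤ α₂(k, N)` for `k ≤ N ≤ N'`** (every `p`, every `d`; the null set of non-lattice configurations is
immaterial). [cite: MartineauTassion2017, proof of Lemma 3.7] -/
theorem annulusTwoArmProb_anti_outer {d : ℕ} (p : unitInterval) {k N N' : ℕ} (hkN : k ≤ N) (hNN' : N ≤ N') :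
    annulusTwoArmProb d p k N' ≤ annulusTwoArmProb d p k N :=
  DCT16.real_mono_of_forall_subset_edgeSet (zdGraph d) p fun _ hω h => mem_compl_uniqZone_of_outer_le hkN hNN' hω h

/-- **The annulus two-arm probability decreases with the aspect ratio**: `m ≤ m' ≤ N' ≤ N` (the annulus `Λ(N') ∖ Λ(m')` lies
inside `Λ(N) ∖ Λ(m)` radially) ⇒ `α₂(m, N) ≤ α₂(m', N')`. [cite: MartineauTassion2017, proof of Lemma 3.7] -/
theorem annulusTwoArmProb_anti_aspect {d : ℕ} (p : unitInterval) {m m' N' N : ℕ} (hm : m ≤ m') (hm'N' : m' ≤ N')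
    (hN : N' ≤ N) : annulusTwoArmProb d p m N ≤ annulusTwoArmProb d p m' N' :=
  (annulusTwoArmProb_anti_outer p (hm.trans hm'N') hN).trans (annulusTwoArmProb_mono_inner p hm)

/-! ## The aspect-2 statement dominates every aspect `≤ 2` -/

/-- **`AnnulusTwoArmLowerBound` (aspect 2) bounds every annulus of aspect at most 2**: if `c ≤ α₂(n, 2n)` for all `n ≥ 1`,
then `c ≤ α₂(m, N)` for all `1 ≤ m < N ≤ 2m`.  In particular the lane's aspect-2 statement implies the conclusion of gen 4's
thin-aspect theorem `annulusTwoArmProb_criticalProbI_lower_of_aspect` (with the constant of the hypothesis), whereas the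
converse direction is an RSW-type step (memo P2-RSWLITE §10, V18). [cite: DuminilcopinKozmaTassion2020, §1.1 (the uniqueness zone at bounded ratio)] -/
theorem forall_aspect_le_two_of_annulusTwoArmLowerBound (h : AnnulusTwoArmLowerBound) :
    ∃ c : ℝ, 0 < c ∧ ∀ m N : ℕ, 1 ≤ m → m < N → N ≤ 2 * m →
      c ≤ annulusTwoArmProb 3 (criticalProbI 3) m N := by
  obtain ⟨c, hc, hcn⟩ := h
  refine ⟨c, hc, fun m N hm hmN hN2 => (hcn m hm).trans ?_⟩
  exact annulusTwoArmProb_anti_outer (criticalProbI 3) hmN.le hN2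

/-- **What the thin-aspect theorem gives toward aspect 2, stated honestly**: for every `n ≥ 1` there is SOME pair of radii
`m < N ≤ 2m` at scale `n` (namely `m = K n`, `N = (K+1) n`) with `α₂(m, N) > δ₂^{49}/2`; by `annulusTwoArmProb_anti_aspect`
the bound propagates to all thinner annuli between them, but not to `(n, 2n)`.  builds on p205010 (kernel theorem, internal
audit signed; external expert review pending). [cite: Aizenman1997, §2 Thm. 2] -/
theorem exists_aspect_le_two_annulusTwoArmProb_criticalProbI :
    ∃ K : ℕ, 1 ≤ K ∧ ∀ n : ℕ, 1 ≤ n → ∀ m N : ℕ, K * n ≤ m → m ≤ N → N ≤ (K + 1) * n →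
      Literature.Probability.Percolation.KestenZhang.critTwoArmsDelta 2 ^ 49 / 2 <
        annulusTwoArmProb 3 (criticalProbI 3) m N := by
  obtain ⟨K, hK, h⟩ := annulusTwoArmProb_criticalProbI_lower_aspect
  refine ⟨K, hK, fun n hn m N hKm hmN hN => (h n hn).trans_le ?_⟩
  exact annulusTwoArmProb_anti_aspect (criticalProbI 3) hKm hmN hN

end Summit.CriticalPhenomena.PercolationContinuityZ3.Theorems.Rsw3

end
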